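import Summits.CriticalPhenomena.PercolationContinuityZ3.Theorems.Transplant.GrigorchukInvertedOrbitGrowth
import Summits.CriticalPhenomena.PercolationContinuityZ3.Theorems.Transplant.GrigorchukLamplighterCayleyClasses
import Summits.CriticalPhenomena.PercolationContinuityZ3.Theorems.Transplant.GrigorchukLamplighterCriticalProbLtOne
import Summits.CriticalPhenomena.PercolationContinuityZ3.Theorems.Transplant.GrigorchukSubexponentialGrowth
import Summits.CriticalPhenomena.PercolationContinuityZ3.Theorems.Transplant.SamePWitnessBoxProdZ2
import Summits.CriticalPhenomena.PercolationContinuityZ3.Theorems.Transplant.StatementPolynomialGrowth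
import Summits.CriticalPhenomena.PercolationContinuityZ3.Theorems.Transplant.CayleyExpGrowthSubset
import Mathlib.Analysis.SpecialFunctions.Pow.Asymptotics
import HarnessLib

/-!
# BARTHOLDI–ERSCHLER'S CAYLEY GRAPH `Cay(ℤ ≀_X 𝔊; a, b, c, d, s)` DOES NOT HAVE EXPONENTIAL GROWTH — hence it is AMENABLE, `p_u = p_c < 1` there,
# and it lies inside the scope of the open residue node `BenjaminiSchramm1996_conj4_amenableSubexponential` with every hypothesis kernel-verified

builds on p205010 (kernel theorem, internal audit signed; external expert review pending) — nothing in this file uses p205010.  Lane `prim-bschramm`, seat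
`prim-bschramm-gen-1` gen 9 (GEN pen; offer O-BE file F-BE3, lead g26 GO 2026-08-28T09:30Z).  Helper file (`--supports stmt-CriticalPhenomena-4575 --as helper`).
DEF-FREE (the lamp code of the count is a local gadget inside one proof); no instance, no notation, no `@[conjecture]`; REUSES F-BE1/F-BE2 («GrigorchukInvertedOrbits»,
«GrigorchukInvertedOrbitGrowth»: `io`, `dlt`, `exists_dlt_le_rpow`, `apply_eq_true_of_mem_io`), G2/G3 (`wball`, `prod_mem_wball`, `wordLW_le`, `gammaW_le_exp`),
«GrigorchukLamplighterShortCycles»/«…CayleyClasses» (`L6`, `prodW`, `treeWords`, `right_prodW`, `Cay`, `cay_adj_iff`), «GrigorchukLamplighterCriticalProbLtOne» p606218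
(`wreathZ_standardGens_criticalProb_lt_one`), «SamePWitnessBoxProdZ2» (`isGraphAmenable_of_not_hasExponentialGrowth`), Literature «UniquenessAmenable» p596858
(`uniquenessProb_eq_criticalProb_of_amenable`), «CayleyMilnorKernel» (`CayleyScaled.connected_mulCayley_of_closure`, `isQuasiTransitive_mulCayley`) and «CayleyExpGrowthSubset»
(`CayleyGrowth.hasExponentialGrowth_of_subset`) — nothing restated.

THE ARGUMENT (Bartholdi–Erschler 2012, §2.2 and the upper half of Lemma 5.1, for `A = ℤ`).  An element of the ball `B(1, n)` of `Cay` is a product `y₁ ⋯ y_k`,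
`k ≤ n`, of letters `a, b, c, d, s^{±1}`; its TREE part is the value of the tree word (weighted length `≤ 3400 n`, so it lies in G2's `wball (3400 n)`), and its
LAMP configuration `f : Ray →₀ ℤ` has `|f(x)| ≤ n`, support inside the inverted orbit `io` of the tree word — of size `≤ 5 n^α` by F-BE2 — and every lit ray agrees
with `ρ` beyond coordinate `⌊log₂ n⌋ + 2` (F-BE2's depth lemma).  Hence (§2) `|B(1,n)| ≤ γ_w(3400 n) · (2^{m+1} (2n+1))^{D}` with `n ≤ 2^m`, `D = ⌊5 n^α⌋`, and with G3's
`γ_w(n) ≤ K_τ e^{τ n}` for every `τ > 0` (§3) **`cay_ballVolume_le_exp : ∀ τ > 0, ∃ K, ∀ n, |B(1,n)| ≤ K e^{τ n}`** and **`cay_not_hasExponentialGrowth`**.  §4 CUSTOMERS, all tree one-liners: **`cay_isGraphAmenable`**,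
**`cay_uniquenessProb_eq_criticalProb`**, **`cay_uniquenessProb_lt_one`** (`p_u = p_c < 1`, kernel), and the SCOPE statement **`cay_theta_eq_zero_of_conj4_amenableSubexponential`**:
the OPEN residue node (a HYPOTHESIS binder here, never asserted) would give `θ(p_c) = 0` at the root of `Cay` — all five of its hypotheses (connected, quasi-transitive,
amenable, not of exponential growth, `p_c < 1`) are kernel theorems for this graph; Hutchcroft's exponential-growth theorem does not apply to it.  §5 the same
for EVERY Cayley graph `Cay(Γ₂; S)`, `S` finite generating (growth type is generating-set independent: «CayleyExpGrowthSubset»; `p_c < 1`: `wreathZ_criticalProb_lt_one`).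
MUST-NOT (lead g26): no growth exponent and no 'intermediate growth' of `ℤ ≀_X 𝔊` is claimed (no lower bound is typed; `α` is a proof constant of F-BE2 bounding orbit
sizes); `θ(p_c)` on `Cay` is NOT proved here or anywhere in the tree; the residue node stays OPEN; nothing about `BenjaminiSchramm1996_conj4_endState`.
[cite: BartholdiErschler2012, §2.2, Lemma 5.1 (upper bound), Thm. 5.3] [cite: LyonsPeres2016, §6.1 p. 279; Thm. 7.6] [cite: BenjaminiSchramm1996, Conj. 4, Conj. 6, Question 3]
[cite: Hutchcroft2016, Thm. 1] [cite: HermonHutchcroft2021, §1]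
-/

noncomputable section

namespace Summit.CriticalPhenomena.PercolationContinuityZ3.Theorems.Transplant
namespace Grigorchuk

open SimpleGraph Filter SemidirectProduct Literature.Barriers.CriticalPhenomena Literature.Probability.Percolation Literature.Probability.LatticeModels
open scoped Classical Topology

/-! ## §1 Products of letters: tree part, lamp support inside the inverted orbit, lamp values bounded by the length -/

/-- The parts of a letter: lamp part `single ρ m` with `|m| ≤ 1` (`m = 0` for tree letters), tree part the value of its tree word. [cite: BartholdiErschler2012, §2 (S = S_A ∪ S_G)] -/
theorem toW_parts (y : L6) : ∃ m : ℤ, |m| ≤ 1 ∧ Multiplicative.toAdd ((y.toW : ↥wreathZ) : LampGroup ℤ).left = Finsupp.single rho m ∧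
    ((y.toW : ↥wreathZ) : LampGroup ℤ).right = evalPerm y.treeWord := by
  refine ⟨y.lsum, by cases y <;> decide, ?_, right_toW y⟩
  cases y
  · simp [L6.toW, L6.lsum, aW, tree]
  · simp [L6.toW, L6.lsum, bW, tree]
  · simp [L6.toW, L6.lsum, cW, tree]
  · simp [L6.toW, L6.lsum, dW, tree]
  · simp [L6.toW, L6.lsum, sW, lamp]
  · rw [L6.toW, Subgroup.coe_inv, coe_sW, lamp_inv]; simp [L6.lsum, lamp]

/-- `x·io(u) ⊆ io(x u)` for a word `x`: the inverted orbit of a concatenation contains the translate of the inverted orbit of its tail. [cite: BartholdiErschler2012, §2.2] -/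
theorem image_evalPerm_subset_io (u : List Letter) : ∀ v : List Letter, (io u).image (evalPerm v) ⊆ io (v ++ u)
  | [] => by rw [evalPerm_nil, List.nil_append]; exact (Finset.image_id (s := io u)).le.trans' (by rfl)
  | x :: v => by
    rw [evalPerm_cons, List.cons_append, io_cons]
    intro z hz
    obtain ⟨y, hy, rfl⟩ := Finset.mem_image.1 hz
    rw [Equiv.Perm.mul_apply]
    exact Finset.mem_insert_of_mem (Finset.mem_image_of_mem _ (image_evalPerm_subset_io u v (Finset.mem_image_of_mem _ hy)))

/-- The tree words have at most one letter per code. [folklore] -/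
theorem length_treeWords_le : ∀ ys : List L6, (treeWords ys).length ≤ ys.length
  | [] => le_rfl
  | y :: ys => by
    rw [treeWords, List.length_append, List.length_cons]
    have : y.treeWord.length ≤ 1 := by cases y <;> decide
    have := length_treeWords_le ys; omega

/-- **THE LAMP CONFIGURATION OF A PRODUCT OF LETTERS is supported inside the inverted orbit of its tree word, with values bounded by the number of letters.**
[cite: BartholdiErschler2012, §2.2 ("the lamps lit … lie on the inverted orbit"), Lemma 5.1] -/
theorem left_prodW : ∀ ys : List L6,
    (Multiplicative.toAdd ((prodW ys : ↥wreathZ) : LampGroup ℤ).left).support ⊆ io (treeWords ys) ∧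
      ∀ x : Ray, |Multiplicative.toAdd ((prodW ys : ↥wreathZ) : LampGroup ℤ).left x| ≤ ys.length
  | [] => by simp [prodW]
  | y :: ys => by
    obtain ⟨hsupp, hval⟩ := left_prodW ys
    obtain ⟨m, hm, hl, hr⟩ := toW_parts y
    have e : Multiplicative.toAdd ((prodW (y :: ys) : ↥wreathZ) : LampGroup ℤ).left =
        Finsupp.single rho m + Finsupp.equivMapDomain (evalPerm y.treeWord) (Multiplicative.toAdd ((prodW ys : ↥wreathZ) : LampGroup ℤ).left) := by
      rw [prodW, Subgroup.coe_mul, mul_left, toAdd_mul, hl, toAdd_lampAut_apply, hr]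
    refine ⟨fun x hx => ?_, fun x => ?_⟩
    · rw [e] at hx
      rw [treeWords]
      rcases Finset.mem_union.1 (Finsupp.support_add hx) with h1 | h2
      · rw [Finset.mem_singleton.1 (Finsupp.support_single_subset h1)]; exact rho_mem_io _
      · refine image_evalPerm_subset_io _ _ ?_
        change x ∈ (Multiplicative.toAdd ((prodW ys : ↥wreathZ) : LampGroup ℤ).left).support.map (evalPerm y.treeWord).toEmbedding at h2
        rw [Finset.mem_map_equiv] at h2
        exact Finset.mem_image.2 ⟨_, hsupp h2, (evalPerm y.treeWord).apply_symm_apply x⟩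
    · rw [e, Finsupp.add_apply, Finsupp.equivMapDomain_apply, Finsupp.single_apply, List.length_cons, Nat.cast_add, Nat.cast_one]
      have h2 := hval ((evalPerm y.treeWord).symm x)
      split_ifs
      · exact (abs_add_le _ _).trans (by linarith)
      · rw [zero_add]; exact h2.trans (by linarith)

/-- **A walk in `Cay` is a product of letters.** [cite: BenjaminiSchramm1996, §2 (Cayley graphs)] -/
theorem exists_prodW_of_walk {u v : ↥wreathZ} (p : Cay.Walk u v) : ∃ ys : List L6, ys.length = p.length ∧ v = u * prodW ys := by
  induction p with
  | nil => exact ⟨[], rfl, by simp [prodW]⟩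
  | cons h p ih =>
    obtain ⟨ys, hlen, hv⟩ := ih
    obtain ⟨y, hy⟩ := cay_adj_iff.1 h
    exact ⟨y :: ys, by rw [List.length_cons, Walk.length_cons, hlen], by rw [hv, hy, prodW, mul_assoc]⟩

/-! ## §2 The count: `|B(1,n)| ≤ γ_w(3400 n) · (2^{m+1}(2n+1))^D` -/

/-- **THE COUNT.**  If every word of length `≤ n` has inverted orbit of size `≤ D` and `n ≤ 2^m`, then
`|B_Cay(1, n)| ≤ γ_w(3400 n) · (2^{m+1} · (2n+1))^D`: the injection `g ↦ (tree part, lamp configuration)` lands in G2's `wball (3400 n)` times the image of the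
LAMP CODES — `D` slots, each a pattern of the first `m + 1` letters of a lit ray and a value in `[-n, n]`, summed as lamps (a local gadget of this proof, no definition).
[cite: BartholdiErschler2012, Lemma 5.1 (upper bound: growth of W ≤ growth of G × number of configurations)] -/
theorem ballVolume_cay_le {n m D : ℕ} (hD : ∀ w : List Letter, w.length ≤ n → dlt w ≤ D) (hm : n ≤ 2 ^ m) :
    ballVolume Cay 1 n ≤ gammaW (3400 * n) * (2 ^ (m + 1) * (2 * n + 1)) ^ D := by
  -- the lamp code of `D` slots (pattern of the first `m+1` letters, value shifted by `n`)
  let ray : (Fin (m + 1) → Bool) → Ray := fun q i => if h : i < m + 1 then q ⟨i, h⟩ else true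
  let code : (Fin D → (Fin (m + 1) → Bool) × Fin (2 * n + 1)) → (Ray →₀ ℤ) := fun t =>
    ∑ j, Finsupp.single (ray (t j).1) (((t j).2 : ℕ) - n : ℤ)
  -- every sparse (`≤ D` points), shallow (lit rays agree with `ρ` beyond `m`) configuration with values in `[-n, n]` is a code
  have hcode : ∀ f : Ray →₀ ℤ, f.support.card ≤ D → (∀ x ∈ f.support, ∀ i, m + 1 ≤ i → x i = true) → (∀ x, |f x| ≤ n) → ∃ t, code t = f := by
    intro f hDf hU hval
    set S := f.support with hS
    set ι : ↥S ↪ Fin D := S.equivFin.toEmbedding.trans (Fin.castLEEmb hDf) with hι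
    let val : ↥S → Fin (2 * n + 1) := fun x => ⟨(f x + n).toNat, by have h2 := abs_le.1 (hval x); omega⟩
    let t : Fin D → (Fin (m + 1) → Bool) × Fin (2 * n + 1) := fun j =>
      if h : ∃ x : ↥S, ι x = j then (fun i => (Classical.choose h : ↥S).1 i, val (Classical.choose h)) else (fun _ => true, ⟨n, by omega⟩)
    refine ⟨t, ?_⟩
    have hzero : ∀ j : Fin D, j ∉ (Finset.univ : Finset ↥S).map ι → Finsupp.single (ray (t j).1) (((t j).2 : ℕ) - n : ℤ) = 0 := by
      intro j hj
      have h : ¬ ∃ x : ↥S, ι x = j := fun ⟨x, hx⟩ => hj (Finset.mem_map.2 ⟨x, Finset.mem_univ _, hx⟩)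
      simp only [t, dif_neg h, sub_self, Finsupp.single_zero]
    have hray : ∀ x : ↥S, ray (fun i => x.1 i) = x.1 := by
      intro x; funext i
      simp only [ray]
      split_ifs with h
      · rfl
      · exact (hU x.1 x.2 i (by omega)).symm
    have hslot : ∀ x : ↥S, Finsupp.single (ray (t (ι x)).1) (((t (ι x)).2 : ℕ) - n : ℤ) = Finsupp.single (x : Ray) (f x) := by
      intro x
      have h : ∃ x' : ↥S, ι x' = ι x := ⟨x, rfl⟩
      have hx : Classical.choose h = x := ι.injective (Classical.choose_spec h)
      simp only [t, dif_pos h, hx, hray]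
      congr 1
      have h2 := abs_le.1 (hval x)
      simp only [val]; omega
    show (∑ j, Finsupp.single (ray (t j).1) (((t j).2 : ℕ) - n : ℤ)) = f
    rw [← Finset.sum_subset (Finset.subset_univ ((Finset.univ : Finset ↥S).map ι)) (fun j _ hj => hzero j hj), Finset.sum_map]
    simp only [hslot]
    rw [Finset.sum_coe_sort S (fun x => Finsupp.single x (f x))]
    exact f.sum_single
  -- the finite target: (tree part, lamp configuration)
  set T : Finset (Equiv.Perm Ray × (Ray →₀ ℤ)) := wball (3400 * n) ×ˢ (Finset.univ.image code) with hT
  have hcard : T.card ≤ gammaW (3400 * n) * (2 ^ (m + 1) * (2 * n + 1)) ^ D := by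
    rw [hT, Finset.card_product, gammaW]
    refine Nat.mul_le_mul_left _ (Finset.card_image_le.trans ?_)
    rw [Finset.card_univ]
    simp only [Fintype.card_fun, Fintype.card_prod, Fintype.card_fin, Fintype.card_bool]
    exact le_rfl
  refine le_trans ?_ hcard
  unfold ballVolume
  rw [← Set.ncard_coe_finset]
  refine Set.ncard_le_ncard_of_injOn (fun g : ↥wreathZ => (((g : LampGroup ℤ)).right, Multiplicative.toAdd ((g : LampGroup ℤ)).left))
    (fun g hg => ?_) (fun g _ g' _ h => ?_) (Finset.finite_toSet _)
  · -- a ball element is a product of `≤ n` letters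
    obtain ⟨p, hp⟩ := hg
    obtain ⟨ys, hlen, hg'⟩ := exists_prodW_of_walk p
    rw [one_mul] at hg'
    subst hg'
    rw [Finset.mem_coe, hT, Finset.mem_product]
    refine ⟨?_, ?_⟩
    · -- tree part
      rw [right_prodW]
      refine wball_mono ?_ (prod_mem_wball (treeWords ys))
      have h1 := wordLW_le (treeWords ys); have h2 := length_treeWords_le ys
      calc wordLW (treeWords ys) ≤ 3400 * (treeWords ys).length := h1
        _ ≤ 3400 * n := Nat.mul_le_mul_left _ (by omega)
    · -- lamp configuration
      obtain ⟨hsupp, hval⟩ := left_prodW ys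
      have htw : (treeWords ys).length ≤ n := (length_treeWords_le ys).trans (by omega)
      obtain ⟨t, ht⟩ := hcode _ ((Finset.card_le_card hsupp).trans (hD _ htw))
        (fun x hx i hi => apply_eq_true_of_mem_io (htw.trans hm) (hsupp hx) hi)
        (fun x => (hval x).trans (by exact_mod_cast hlen.le.trans hp))
      exact Finset.mem_image.2 ⟨t, Finset.mem_univ _, ht⟩
  · -- injectivity: an element of the semidirect product is its two parts
    simp only [Prod.mk.injEq] at h
    exact Subtype.ext (SemidirectProduct.ext (Multiplicative.toAdd.injective h.2) h.1)

/-! ## §3 No exponential growth -/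

/-- **The orbit bound in the needed form**: for `n ≥ 1`, every word of length `≤ n` has `δ(w) ≤ ⌊5 n^α⌋`. [cite: BartholdiErschler2012, Cor. 4.8 (upper bound)] -/
theorem dlt_le_floor {α : ℝ} (hα0 : 0 ≤ α) (hα : ∀ w : List Letter, w ≠ [] → (dlt w : ℝ) ≤ 5 * (w.length : ℝ) ^ α) {n : ℕ} (hn : 1 ≤ n)
    (w : List Letter) (hw : w.length ≤ n) : dlt w ≤ ⌊5 * (n : ℝ) ^ α⌋₊ := by
  refine Nat.le_floor ?_
  have hnα : (1 : ℝ) ≤ (n : ℝ) ^ α := Real.one_le_rpow (by exact_mod_cast hn) hα0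
  by_cases h : w = []
  · subst h; simp [dlt]; linarith
  · refine (hα w h).trans (mul_le_mul_of_nonneg_left (Real.rpow_le_rpow (Nat.cast_nonneg _) (by exact_mod_cast hw) hα0) (by norm_num))

/-- **The ball bound in closed form**: for `n ≥ 1`, `|B(1,n)| ≤ γ_w(3400 n) · (12 n²)^{5 n^α}` (`m = ⌊log₂ n⌋ + 1`, so `2^{m+1} ≤ 4n`). [cite: BartholdiErschler2012, Lemma 5.1] -/
theorem ballVolume_cay_le_rpow {α : ℝ} (hα0 : 0 ≤ α) (hα : ∀ w : List Letter, w ≠ [] → (dlt w : ℝ) ≤ 5 * (w.length : ℝ) ^ α) {n : ℕ} (hn : 1 ≤ n) :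
    (ballVolume Cay 1 n : ℝ) ≤ gammaW (3400 * n) * ((12 : ℝ) * n ^ 2) ^ (5 * (n : ℝ) ^ α) := by
  set m := Nat.log 2 n + 1 with hm
  have hnm : n ≤ 2 ^ m := (Nat.lt_pow_succ_log_self (by norm_num) n).le
  have h2m : 2 ^ (m + 1) ≤ 4 * n := by
    rw [hm, pow_succ, pow_succ]; have := Nat.pow_log_le_self 2 (show n ≠ 0 by omega); omega
  have h := ballVolume_cay_le (dlt_le_floor hα0 hα hn) hnm
  have hbase : ((2 : ℝ) ^ (m + 1) * (2 * n + 1)) ≤ 12 * (n : ℝ) ^ 2 := by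
    have h1 : ((2 : ℝ) ^ (m + 1)) ≤ 4 * n := by exact_mod_cast h2m
    have h1' : (1 : ℝ) ≤ n := by exact_mod_cast hn
    have h2 : (2 : ℝ) * n + 1 ≤ 3 * n := by linarith
    calc ((2 : ℝ) ^ (m + 1) * (2 * n + 1)) ≤ 4 * n * (3 * n) := mul_le_mul h1 h2 (by positivity) (by positivity)
      _ = 12 * (n : ℝ) ^ 2 := by ring
  have hbase1 : (1 : ℝ) ≤ (2 : ℝ) ^ (m + 1) * (2 * n + 1) := by
    have : (1 : ℝ) ≤ 2 ^ (m + 1) := one_le_pow₀ (by norm_num); nlinarith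
  calc (ballVolume Cay 1 n : ℝ) ≤ gammaW (3400 * n) * ((2 : ℝ) ^ (m + 1) * (2 * n + 1)) ^ (⌊5 * (n : ℝ) ^ α⌋₊ : ℝ) := by
        rw [Real.rpow_natCast]; exact_mod_cast h
    _ ≤ gammaW (3400 * n) * ((2 : ℝ) ^ (m + 1) * (2 * n + 1)) ^ (5 * (n : ℝ) ^ α) := by
        refine mul_le_mul_of_nonneg_left (Real.rpow_le_rpow_of_exponent_le hbase1 (Nat.floor_le (by positivity))) (Nat.cast_nonneg _)
    _ ≤ gammaW (3400 * n) * ((12 : ℝ) * n ^ 2) ^ (5 * (n : ℝ) ^ α) :=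
        mul_le_mul_of_nonneg_left (Real.rpow_le_rpow (by positivity) hbase (by positivity)) (Nat.cast_nonneg _)

/-- **Sublinearity of the exponent**: `5 x^α log(12 x²) ≤ ε x` for all large real `x` (`α < 1`). [folklore] -/
theorem eventually_rpow_mul_log_le {α : ℝ} (hα1 : α < 1) {ε : ℝ} (hε : 0 < ε) :
    ∀ᶠ x : ℝ in atTop, 5 * x ^ α * Real.log (12 * x ^ 2) ≤ ε * x := by
  have hlo := (isLittleO_log_rpow_atTop (show 0 < 1 - α by linarith)).def (show 0 < ε / 15 by positivity)
  filter_upwards [hlo, eventually_ge_atTop (12 : ℝ)] with x hx hx12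
  have hx0 : 0 < x := by linarith
  have hlog12 : Real.log 12 ≤ Real.log x := Real.log_le_log (by norm_num) hx12
  have hlogx : 0 ≤ Real.log x := Real.log_nonneg (by linarith)
  rw [Real.norm_of_nonneg hlogx, Real.norm_of_nonneg (Real.rpow_nonneg hx0.le _)] at hx
  have hl : Real.log (12 * x ^ 2) ≤ 3 * Real.log x := by
    rw [Real.log_mul (by norm_num) (by positivity), Real.log_pow]; push_cast; linarith
  have hxa : 0 ≤ x ^ α := Real.rpow_nonneg hx0.le _
  calc 5 * x ^ α * Real.log (12 * x ^ 2) ≤ 5 * x ^ α * (3 * Real.log x) := mul_le_mul_of_nonneg_left hl (by positivity)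
    _ = 15 * (x ^ α * Real.log x) := by ring
    _ ≤ 15 * (x ^ α * (ε / 15 * x ^ (1 - α))) := by gcongr
    _ = ε * (x ^ α * x ^ (1 - α)) := by ring
    _ = ε * x := by rw [← Real.rpow_add hx0, add_sub_cancel, Real.rpow_one]

/-- **SUBEXPONENTIAL GROWTH OF `Cay(ℤ ≀_X 𝔊; a, b, c, d, s)`, uniform form (mirror of G3's `gammaW_le_exp`): for every rate `τ > 0` there is `K` with
`|B(1, n)| ≤ K e^{τ n}` for ALL `n`** — three factors at `τ/3`: `γ_w(3400 n) ≤ K₁ e^{(τ/3) n}` (G3), `(12n²)^{5n^α} ≤ e^{(τ/3) n}` and `K₁ ≤ e^{(τ/3) n}` eventually; the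
finitely many small `n` are absorbed into `K`.  UPPER bound only — nothing about a lower bound or a growth exponent of `ℤ ≀_X 𝔊`.
[cite: BartholdiErschler2012, Lemma 5.1 and Thm. 5.3 (upper half)] -/
theorem cay_ballVolume_le_exp {τ : ℝ} (hτ : 0 < τ) : ∃ K : ℝ, ∀ n : ℕ, (ballVolume Cay 1 n : ℝ) ≤ K * Real.exp (τ * n) := by
  obtain ⟨α, hα0, hα1, hα⟩ := exists_dlt_le_rpow
  obtain ⟨K₁, hK₁⟩ := gammaW_le_exp (show 0 < τ / (3 * 3400) by positivity)
  have hK₁0 : 0 < K₁ := by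
    have h1 := hK₁ 0
    have h2 : (1 : ℝ) ≤ gammaW 0 := by exact_mod_cast gammaW_pos 0
    simp at h1; linarith
  -- eventually: the orbit exponent is `≤ (τ/3) n` and `K₁ < e^{(τ/3) n}`
  have hε := (eventually_rpow_mul_log_le hα1 (show 0 < τ / 3 by positivity)).and
    ((Real.tendsto_exp_atTop.comp (tendsto_id.const_mul_atTop (show 0 < τ / 3 by positivity))).eventually_gt_atTop K₁)
  obtain ⟨N, hN⟩ := (tendsto_natCast_atTop_atTop.eventually hε).exists_forall_of_atTop
  -- the large `n`
  have hlarge : ∀ n : ℕ, N ≤ n → 1 ≤ n → (ballVolume Cay 1 n : ℝ) ≤ Real.exp (τ * n) := by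
    intro n hn hn1
    obtain ⟨hexp, hKn⟩ := hN n hn
    have hKn' : K₁ < Real.exp (τ / 3 * n) := by simpa using hKn
    have hγ : (gammaW (3400 * n) : ℝ) ≤ K₁ * Real.exp (τ / 3 * n) := by
      refine (hK₁ (3400 * n)).trans (le_of_eq ?_)
      congr 1; push_cast; ring
    have hconf : ((12 : ℝ) * n ^ 2) ^ (5 * (n : ℝ) ^ α) ≤ Real.exp (τ / 3 * n) := by
      have hn0 : (0 : ℝ) < n := by exact_mod_cast hn1
      rw [Real.rpow_def_of_pos (by positivity), Real.exp_le_exp, mul_comm]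
      exact hexp
    calc (ballVolume Cay 1 n : ℝ) ≤ gammaW (3400 * n) * ((12 : ℝ) * n ^ 2) ^ (5 * (n : ℝ) ^ α) := ballVolume_cay_le_rpow hα0.le hα hn1
      _ ≤ K₁ * Real.exp (τ / 3 * n) * Real.exp (τ / 3 * n) := mul_le_mul hγ hconf (by positivity) (by positivity)
      _ ≤ Real.exp (τ / 3 * n) * Real.exp (τ / 3 * n) * Real.exp (τ / 3 * n) := by gcongr
      _ = Real.exp (τ * n) := by rw [← Real.exp_add, ← Real.exp_add]; ring_nf
  -- absorb `n < N` (and `n = 0`) into the constant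
  refine ⟨1 + ∑ k ∈ Finset.range (N + 1), (ballVolume Cay 1 k : ℝ), fun n => ?_⟩
  have hexp1 : (1 : ℝ) ≤ Real.exp (τ * n) := Real.one_le_exp (by positivity)
  have hsum0 : (0 : ℝ) ≤ ∑ k ∈ Finset.range (N + 1), (ballVolume Cay 1 k : ℝ) := Finset.sum_nonneg fun _ _ => Nat.cast_nonneg _
  by_cases hn : N ≤ n ∧ 1 ≤ n
  · calc (ballVolume Cay 1 n : ℝ) ≤ Real.exp (τ * n) := hlarge n hn.1 hn.2
      _ ≤ (1 + ∑ k ∈ Finset.range (N + 1), (ballVolume Cay 1 k : ℝ)) * Real.exp (τ * n) := by nlinarith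
  · have hnN : n ∈ Finset.range (N + 1) := by rw [Finset.mem_range]; omega
    have hle : (ballVolume Cay 1 n : ℝ) ≤ ∑ k ∈ Finset.range (N + 1), (ballVolume Cay 1 k : ℝ) :=
      Finset.single_le_sum (fun _ _ => Nat.cast_nonneg _) hnN
    nlinarith

/-- **BARTHOLDI–ERSCHLER'S CAYLEY GRAPH `Cay(ℤ ≀_X 𝔊; a, b, c, d, s)` DOES NOT HAVE EXPONENTIAL GROWTH** (the tree's eventual form `∀ x ∃ c > 1, c^n ≤ |B(x,n)|`
eventually, refuted at `x = 1`: `|B(1,n)| ≤ K (√c)^n` contradicts `c^n ≤ |B(1,n)|`; G3's filter argument).  Hutchcroft's exponential-growth HYPOTHESIS fails on this graph —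
nothing is 'refuted' about his theorem or any node. [cite: BartholdiErschler2012, Thm. 5.3 (upper half)] [cite: Hutchcroft2016, §1 (definition of exponential growth)] -/
theorem cay_not_hasExponentialGrowth : ¬ HasExponentialGrowth Cay := by
  intro h
  obtain ⟨c, hc, hev⟩ := h 1
  have hc0 : 0 < c := by linarith
  set r : ℝ := Real.exp (Real.log c / 2) with hr
  have hr1 : 1 < r := by rw [hr]; exact Real.one_lt_exp_iff.2 (by have := Real.log_pos hc; linarith)
  have hr0 : 0 < r := by linarith
  have hrr : r * r = c := by rw [hr, ← Real.exp_add, add_halves, Real.exp_log hc0]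
  obtain ⟨K, hK⟩ := cay_ballVolume_le_exp (show 0 < Real.log c / 2 by have := Real.log_pos hc; positivity)
  have hbound : ∀ᶠ n : ℕ in atTop, r ^ n ≤ K := by
    filter_upwards [hev] with n hn
    have h2 := hK n
    have h3 : Real.exp (Real.log c / 2 * (n : ℝ)) = r ^ n := by rw [hr, ← Real.exp_nat_mul]; ring_nf
    rw [h3] at h2
    have h4 : c ^ n = r ^ n * r ^ n := by rw [← mul_pow, hrr]
    have h5 : r ^ n * r ^ n ≤ K * r ^ n := by rw [← h4]; exact hn.trans h2
    exact le_of_mul_le_mul_right h5 (pow_pos hr0 n)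
  obtain ⟨n, hn1, hn2⟩ := (hbound.and ((tendsto_pow_atTop_atTop_of_one_lt hr1).eventually_gt_atTop K)).exists
  exact absurd hn1 (not_le.2 hn2)

/-! ## §4 Customers: amenability, `p_u = p_c < 1`, and the scope of the residue node -/

/-- `Cay` is connected (`Cay = mulCayley ↑stdGens` by definition; the percolation functionals below are written on `mulCayley ↑stdGens`, whose local finiteness
instance is the tree's `instLocallyFiniteMulCayley`). [cite: BenjaminiSchramm1996, §2 (Cayley graphs)] -/
theorem cay_connected : (mulCayley (↑stdGens : Set ↥wreathZ)).Connected :=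
  CayleyScaled.connected_mulCayley_of_closure _ closure_standardGens_finset

/-- `Cay` is quasi-transitive. [cite: BenjaminiSchramm1996, §2 (Cayley graphs are transitive)] -/
theorem cay_isQuasiTransitive : IsQuasiTransitive (mulCayley (↑stdGens : Set ↥wreathZ)) :=
  CayleyScaled.isQuasiTransitive_mulCayley _

/-- **`Cay(ℤ ≀_X 𝔊; a, b, c, d, s)` IS AMENABLE** (quasi-transitive without exponential growth). [cite: LyonsPeres2016, §6.1 p. 279 (nonamenable ⇒ exponential growth)]
[cite: BartholdiErschler2012, Thm. 5.3] -/
theorem cay_isGraphAmenable : IsGraphAmenable (mulCayley (↑stdGens : Set ↥wreathZ)) :=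
  isGraphAmenable_of_not_hasExponentialGrowth _ cay_isQuasiTransitive cay_not_hasExponentialGrowth

/-- **`p_u = p_c` ON BARTHOLDI–ERSCHLER'S CAYLEY GRAPH** (amenable quasi-transitive; Literature «UniquenessAmenable»). [cite: LyonsPeres2016, Thm. 7.6]
[cite: BenjaminiSchramm1996, Conj. 6 (amenability side)] -/
theorem cay_uniquenessProb_eq_criticalProb (g : ↥wreathZ) :
    uniquenessProb (mulCayley (↑stdGens : Set ↥wreathZ)) = criticalProb (mulCayley (↑stdGens : Set ↥wreathZ)) g :=
  uniquenessProb_eq_criticalProb_of_amenable _ cay_connected cay_isQuasiTransitive cay_isGraphAmenable g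

/-- **`p_c(Cay) < 1` at every vertex** (p606218, in `stdGens` spelling). [cite: BartholdiErschler2012, §2] [cite: LyonsPeres2016, §7.4 Thm. 7.15] -/
theorem cay_criticalProb_lt_one (g : ↥wreathZ) : criticalProb (mulCayley (↑stdGens : Set ↥wreathZ)) g < 1 :=
  wreathZ_standardGens_criticalProb_lt_one g

/-- **`p_u(Cay(ℤ ≀_X 𝔊; a, b, c, d, s)) < 1`**: a non-trivial uniqueness phase on the frontier graph (amenability + p606218's `p_c < 1`) — kernel.  Nothing about `θ(p_c)`.
[cite: LyonsPeres2016, Thm. 7.6] [cite: BenjaminiSchramm1996, Question 3] [cite: BartholdiErschler2012, Thm. 5.3] -/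
theorem cay_uniquenessProb_lt_one : uniquenessProb (mulCayley (↑stdGens : Set ↥wreathZ)) < 1 := by
  rw [cay_uniquenessProb_eq_criticalProb 1]; exact cay_criticalProb_lt_one 1

/-- **SCOPE OF THE RESIDUE NODE.**  Bartholdi–Erschler's Cayley graph satisfies EVERY hypothesis of the open residue node `BenjaminiSchramm1996_conj4_amenableSubexponential`
(connected, quasi-transitive, amenable, not of exponential growth, `p_c < 1` — all kernel theorems above), so that node — taken here as a HYPOTHESIS, never asserted,
OPEN in print and in the tree — would give `θ(p_c) = 0` at every vertex of it.  `θ(p_c)` on this graph is NOT proved. [cite: BenjaminiSchramm1996, Conj. 4]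
[cite: HermonHutchcroft2021, §1 (the open regime)] [cite: Hutchcroft2016, Thm. 1 (needs exponential growth — absent here)] -/
theorem cay_theta_eq_zero_of_conj4_amenableSubexponential (h : BenjaminiSchramm1996_conj4_amenableSubexponential) (g : ↥wreathZ) :
    theta (mulCayley (↑stdGens : Set ↥wreathZ)) g (criticalProbIOf (mulCayley (↑stdGens : Set ↥wreathZ)) g) = 0 :=
  h _ cay_connected cay_isQuasiTransitive cay_isGraphAmenable cay_not_hasExponentialGrowth g (cay_criticalProb_lt_one g)

/-! ## §5 Every Cayley graph of `Γ₂` (change of finite generating set) -/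

/-- **NO Cayley graph `Cay(Γ₂; S)`, `S ⊆ Γ₂` finite (generating or not), has exponential growth** (an `S`-word of exponential growth would give one in the standard
letters — «CayleyExpGrowthSubset»).  Upper bound only. [cite: MilnorSolvableGrowth1968, p. 447] [cite: BartholdiErschler2012, Thm. 5.3] -/
theorem cayley_gens_not_hasExponentialGrowth (S : Finset ↥wreathZ) : ¬ HasExponentialGrowth (mulCayley (↑S : Set ↥wreathZ)) := fun h =>
  cay_not_hasExponentialGrowth (CayleyGrowth.hasExponentialGrowth_of_subset S stdGens closure_standardGens_finset h)

/-- **Every Cayley graph of `Γ₂` is amenable** (quasi-transitive without exponential growth; for a non-generating `S` the graph is disconnected and the statement is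
the same edge-isoperimetric one). [cite: LyonsPeres2016, §6.1 p. 279] -/
theorem cayley_gens_isGraphAmenable (S : Finset ↥wreathZ) : IsGraphAmenable (mulCayley (↑S : Set ↥wreathZ)) :=
  isGraphAmenable_of_not_hasExponentialGrowth _ (CayleyScaled.isQuasiTransitive_mulCayley S) (cayley_gens_not_hasExponentialGrowth S)

/-- **`p_u = p_c < 1` on EVERY Cayley graph of `Γ₂`** (amenability + `wreathZ_criticalProb_lt_one`). [cite: LyonsPeres2016, Thm. 7.6] [cite: BenjaminiSchramm1996, Question 3] -/
theorem cayley_gens_uniquenessProb (S : Finset ↥wreathZ) (hS : Subgroup.closure (↑S : Set ↥wreathZ) = ⊤) (g : ↥wreathZ) :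
    uniquenessProb (mulCayley (↑S : Set ↥wreathZ)) = criticalProb (mulCayley (↑S : Set ↥wreathZ)) g ∧ uniquenessProb (mulCayley (↑S : Set ↥wreathZ)) < 1 := by
  have h := uniquenessProb_eq_criticalProb_of_amenable _ (CayleyScaled.connected_mulCayley_of_closure S hS) (CayleyScaled.isQuasiTransitive_mulCayley S)
    (cayley_gens_isGraphAmenable S) g
  exact ⟨h, h ▸ wreathZ_criticalProb_lt_one S hS g⟩

/-- **SCOPE, every generating set**: the residue node (a HYPOTHESIS) would give `θ(p_c) = 0` on every Cayley graph of `Γ₂`; all its hypotheses are kernel theorems there.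
`θ(p_c)` itself is NOT proved. [cite: BenjaminiSchramm1996, Conj. 4] [cite: HermonHutchcroft2021, §1] -/
theorem cayley_gens_theta_eq_zero_of_conj4_amenableSubexponential (h : BenjaminiSchramm1996_conj4_amenableSubexponential) (S : Finset ↥wreathZ)
    (hS : Subgroup.closure (↑S : Set ↥wreathZ) = ⊤) (g : ↥wreathZ) :
    theta (mulCayley (↑S : Set ↥wreathZ)) g (criticalProbIOf (mulCayley (↑S : Set ↥wreathZ)) g) = 0 :=
  h _ (CayleyScaled.connected_mulCayley_of_closure S hS) (CayleyScaled.isQuasiTransitive_mulCayley S) (cayley_gens_isGraphAmenable S)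
    (cayley_gens_not_hasExponentialGrowth S) g (wreathZ_criticalProb_lt_one S hS g)

end Grigorchuk
end Summit.CriticalPhenomena.PercolationContinuityZ3.Theorems.Transplant
end
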